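import Mathlib.Analysis.Calculus.MeanValue
import Mathlib.Analysis.InnerProductSpace.Calculus
import Mathlib.Data.Set.Finite.List
import Literature.Analysis.PDE.SymmetricHyperbolicDerived
import Literature.Analysis.PDE.LinearSystemJointSmoothness
import Literature.Analysis.FluidPDE.HyperbolicConeEnergy
import Literature.Analysis.FunctionSpaces.FlatTorusProofs
import Literature.Analysis.FunctionSpaces.TorusCalculusProofs
import HarnessLib

/-!
# Linear symmetric hyperbolic systems on the flat torus, I: periodic lifts of smooth coefficients
# are regular admissible families, and the domain of dependence of the lifted system
# (topic `Analysis/PDE`)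

Analysis/PDE support file (everything proved; no definitions, no named facts). Second brick of
the EXISTENCE MECHANISM of the classical local theory of quasilinear symmetrisable hyperbolic
systems on `𝕋^d` (Dafermos 2005, Thm 5.1.1, whose linearised iteration (5.1.10) "employ[s] the
classical theory of symmetrizable linear hyperbolic systems"; Majda 1984, Ch. 2 §2.1, proof of
Thm 2.1). The linear theory on the torus is obtained (in the sequel
`TorusLinearSymmetricHyperbolicExistence.lean`) by TRANSFER from the tree's whole-space theorem
`exists_smooth_solution` (`SymmetricHyperbolicExistence.lean`: Friedrichs 1954 for
`∂ₜU = ∑ⱼ Aⱼ(t,x) ∂ⱼU + B(t,x) U` on `ℝ × ℝⁿ`, `C_c^∞` data) combined with finite speed of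
propagation (`coneEnergy_eq_zero`, `FluidPDE/HyperbolicConeEnergy.lean`, Racke 2015 Thm 3.1). This
file supplies the two inputs of that transfer:

* **Part A — lifts.** For jointly smooth operator fields `A ⱼ, B : ℝ × 𝕋^ι → (W →L[ℝ] W)`
  (`Torus.IsSmoothSpaceTimeOn univ`) with the `Aⱼ` pointwise symmetric, the periodic lifts
  `(t, y) ↦ Aⱼ(t, proj y)`, `B(t, proj y)` form a regular admissible family
  (`isRegularSymmCoeffFamily_lift` : `IsRegularSymmCoeffFamily`): word derivatives of lifts are
  lattice periodic (`cwd_lift_add_latticeVec`), hence bounded on `[-T, T] × ℝ^ι` by compactness of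
  `[-T, T] × [0,1]^ι` (`exists_norm_cwd_lift_le`), jointly smooth (`contDiff_cwd_slice`), and
  Lipschitz in time uniformly in space by the mean value theorem (`exists_lipschitz_cwd_lift`).
* **Part B — domain of dependence for the linear system on `ℝ × ℝⁿ`.** If `D` is a jointly `C¹`
  solution of `∂ₜD = ∑ⱼ aⱼ ∂ⱼD + b D` with `C¹` symmetric `aⱼ`, `‖aⱼ‖, ‖b‖, ‖∂ⱼaⱼ‖ ≤ M` on the
  slab, and `D(0, ·) = 0` on `B̄(x₁, R)`, then `D(t, y) = 0` for `dist(y, x₁) < R - nM|t|`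
  (`symmHyp_eq_zero_of_data_zero_ball`, forward in time, from `coneEnergy_eq_zero` with energy
  `‖D‖²` and fluxes `-⟪D, aⱼD⟫`, Racke (3.9)–(3.11); `symmHyp_eq_zero_of_data_zero_ball_abs`, both
  time directions, by time reflection `hasDerivAt_foOp_reflect`).

Nothing here is specific to a torus dimension except Part B, which is stated on
`EuclideanSpace ℝ (Fin n)` because `coneEnergy_eq_zero` is.

## Mathlib / tree search

Tree: `cwd`, `cwd_cons`, `bv_eq_single` (`CoordWordDeriv`); `contDiff_cwd_slice`,
`hasDerivAt_slice`, `fderiv_slice_apply` (`LinearSystemJointSmoothness`); `foOp`,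
`IsSymmCoeff`, `IsSymmCoeffFamily`, `IsRegularSymmCoeffFamily`
(`SymmetricHyperbolicEnergy/Regularised/Derived`); `coneEnergy_eq_zero`
(`FluidPDE/HyperbolicConeEnergy`); `Torus.lift`, `proj_add_latticeVec`,
`exists_repr_proj_eq_add_latticeVec_holds`, `isCompact_toLp_image_pi_Icc`,
`repr_mem_toLp_image_pi_Icc` (`FlatTorus(Proofs)`, `TorusCalculusProofs`). Mathlib:
`fderiv_comp_add_right`, `Convex.norm_image_sub_le_of_norm_hasDerivWithin_le`,
`List.finite_length_le`, `HasDerivAt.norm_sq`, `HasFDerivAt.inner`, `HasFDerivAt.clm_apply`.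

## References

* C. M. Dafermos, *Hyperbolic Conservation Laws in Continuum Physics*, 2nd ed., Springer 2005,
  Ch. V §5.1, proof of Thm 5.1.1. [`Dafermos2005`]
* K. O. Friedrichs, *Symmetric hyperbolic linear differential equations*, Comm. Pure Appl.
  Math. 7 (1954) 345–392, §1 (coefficients with bounded derivatives), §6 (domain of
  dependence). [`Friedrichs1954`]
* R. Racke, *Lectures on Nonlinear Evolution Equations*, 2nd ed., Birkhäuser 2015, Ch. 3,
  Thm 3.1 and the Remark after Cor. 3.2 (finite propagation speed). [`Racke2015`]
-/

noncomputable section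

open Set Function Filter Metric
open scoped ContDiff InnerProductSpace Topology

namespace Literature.Analysis.PDE

open Literature.Analysis.FunctionSpaces Literature.Analysis.FunctionSpaces.Torus

/-! ## Part A: periodic lifts of jointly smooth torus fields -/

section Periodic

variable {ι : Type*} [Fintype ι] [DecidableEq ι]
variable {V : Type*} [NormedAddCommGroup V] [NormedSpace ℝ V]

omit [DecidableEq ι] in
/-- **Word derivatives commute with translations**: `∂_v (f(· + a)) = (∂_v f)(· + a)`
(Mathlib `fderiv_comp_add_right`, iterated). [folklore] -/
theorem cwd_comp_add_right (v : List ι) (f : EuclideanSpace ℝ ι → V) (a : EuclideanSpace ℝ ι) :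
    cwd v (fun y => f (y + a)) = fun y => cwd v f (y + a) := by
  induction v with
  | nil => rfl
  | cons i v ih =>
    funext y
    rw [cwd_cons, cwd_cons, ih]
    show fderiv ℝ (fun y => cwd v f (y + a)) y (bv i) = fderiv ℝ (cwd v f) (y + a) (bv i)
    rw [fderiv_comp_add_right]

/-- **Word derivatives of a periodic lift are lattice periodic**:
`∂_v(f ∘ proj)(y + k) = ∂_v(f ∘ proj)(y)` for `k ∈ ℤ^ι`. [folklore] -/
theorem cwd_lift_add_latticeVec (v : List ι) (f : UnitAddTorus ι → V) (y : EuclideanSpace ℝ ι)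
    (k : ι → ℤ) : cwd v (lift f) (y + latticeVec k) = cwd v (lift f) y := by
  have h : (fun z => lift f (z + latticeVec k)) = lift f := by
    funext z
    simp only [lift_apply, proj_add_latticeVec]
  have h2 := congr_fun (cwd_comp_add_right v (lift f) (latticeVec k)) y
  rw [h] at h2
  exact h2.symm

omit [NormedSpace ℝ V] in
/-- **A continuous function on `[-T, T] × ℝ^ι`, lattice periodic in the space variable, is
bounded** (it takes all its values on the compact set `[-T, T] × [0, 1]^ι`). [folklore] -/
theorem exists_forall_norm_le_of_periodic {Φ : ℝ × EuclideanSpace ℝ ι → V} (hΦ : Continuous Φ)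
    (hper : ∀ (t : ℝ) (y : EuclideanSpace ℝ ι) (k : ι → ℤ), Φ (t, y + latticeVec k) = Φ (t, y))
    (T : ℝ) : ∃ C, ∀ t ∈ Icc (-T) T, ∀ y, ‖Φ (t, y)‖ ≤ C := by
  obtain ⟨C, hC⟩ := (isCompact_Icc.prod (isCompact_toLp_image_pi_Icc (d := ι))).exists_bound_of_continuousOn
    (f := Φ) hΦ.continuousOn
  refine ⟨C, fun t ht y => ?_⟩
  obtain ⟨k, hk⟩ := exists_repr_proj_eq_add_latticeVec_holds y
  have h := hC (t, repr (proj y)) (mk_mem_prod ht (repr_mem_toLp_image_pi_Icc _))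
  rwa [hk, hper] at h

omit [DecidableEq ι] in
/-- A field jointly smooth on all of `ℝ × 𝕋^ι` has a `C^∞` space–time lift. [folklore] -/
theorem contDiff_stLift_of_univ {F' : ℝ → UnitAddTorus ι → V} (hF : IsSmoothSpaceTimeOn univ F') :
    ContDiff ℝ ∞ (stLift F') := by
  unfold IsSmoothSpaceTimeOn at hF
  rwa [univ_prod_univ, contDiffOn_univ] at hF

omit [DecidableEq ι] in
/-- **Word derivatives of the lifted slices are jointly smooth**:
`(t, y) ↦ ∂_v (F'(t) ∘ proj)(y)` is `C^∞` on `ℝ × ℝ^ι`. [folklore] -/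
theorem contDiff_cwd_lift_slice {F' : ℝ → UnitAddTorus ι → V} (hF : IsSmoothSpaceTimeOn univ F')
    (v : List ι) : ContDiff ℝ ∞ fun p : ℝ × EuclideanSpace ℝ ι => cwd v (lift (F' p.1)) p.2 :=
  contDiff_cwd_slice (contDiff_stLift_of_univ hF) v

/-- **Word derivatives of the lifted slices are bounded, locally uniformly in time**: for every
word `v` and horizon `T` there is `C` with `‖∂_v(F'(t) ∘ proj)(y)‖ ≤ C` for `|t| ≤ T` and all
`y ∈ ℝ^ι` (Friedrichs 1954, §1: coefficients with bounded derivatives).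
[cite: Friedrichs1954, §1] -/
theorem exists_norm_cwd_lift_le {F' : ℝ → UnitAddTorus ι → V} (hF : IsSmoothSpaceTimeOn univ F')
    (v : List ι) (T : ℝ) : ∃ C, ∀ t ∈ Icc (-T) T, ∀ y, ‖cwd v (lift (F' t)) y‖ ≤ C :=
  exists_forall_norm_le_of_periodic (contDiff_cwd_lift_slice hF v).continuous
    (fun t y k => cwd_lift_add_latticeVec v (F' t) y k) T

/-- **Word derivatives of the lifted slices are Lipschitz in time, uniformly in space, on compact
time intervals** (mean value theorem in `t`; the time derivative of the jointly smooth, spatially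
periodic field `(t, y) ↦ ∂_v(F'(t) ∘ proj)(y)` is bounded on `[-T, T] × ℝ^ι`).
[cite: Friedrichs1954, §1] -/
theorem exists_lipschitz_cwd_lift {F' : ℝ → UnitAddTorus ι → V}
    (hF : IsSmoothSpaceTimeOn univ F') (v : List ι) (T : ℝ) :
    ∃ L, 0 ≤ L ∧ ∀ s ∈ Icc (-T) T, ∀ t ∈ Icc (-T) T, ∀ y,
      ‖cwd v (lift (F' t)) y - cwd v (lift (F' s)) y‖ ≤ L * |t - s| := by
  set Φ : ℝ × EuclideanSpace ℝ ι → V := fun p => cwd v (lift (F' p.1)) p.2 with hΦ_def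
  have hΦ : ContDiff ℝ ∞ Φ := contDiff_cwd_lift_slice hF v
  set Ψ : ℝ × EuclideanSpace ℝ ι → V := fun p => fderiv ℝ Φ p (1, 0) with hΨ_def
  have hΨc : Continuous Ψ := (hΦ.continuous_fderiv (by simp)).clm_apply continuous_const
  have hΦper : ∀ (t : ℝ) (y : EuclideanSpace ℝ ι) (k : ι → ℤ),
      Φ (t, y + latticeVec k) = Φ (t, y) := fun t y k => cwd_lift_add_latticeVec v (F' t) y k
  have hΨper : ∀ (t : ℝ) (y : EuclideanSpace ℝ ι) (k : ι → ℤ),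
      Ψ (t, y + latticeVec k) = Ψ (t, y) := by
    intro t y k
    have h : (fun p : ℝ × EuclideanSpace ℝ ι => Φ (p + (0, latticeVec k))) = Φ := by
      funext p
      obtain ⟨s, z⟩ := p
      show Φ (s + 0, z + latticeVec k) = Φ (s, z)
      rw [add_zero, hΦper]
    have h2 : fderiv ℝ Φ ((t, y) + (0, latticeVec k)) =
        fderiv ℝ (fun p => Φ (p + (0, latticeVec k))) (t, y) :=
      (fderiv_comp_add_right (0, latticeVec k)).symm
    have h3 : ((t, y + latticeVec k) : ℝ × EuclideanSpace ℝ ι) = (t, y) + (0, latticeVec k) := by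
      simp
    simp only [hΨ_def]
    rw [h3, h2, h]
  obtain ⟨L, hL⟩ := exists_forall_norm_le_of_periodic hΨc hΨper T
  refine ⟨max L 0, le_max_right _ _, fun s hs t ht y => ?_⟩
  have hderiv : ∀ r ∈ Icc (-T) T,
      HasDerivWithinAt (fun r => Φ (r, y)) (Ψ (r, y)) (Icc (-T) T) r := fun r _ =>
    (hasDerivAt_slice (p := (r, y)) (hΦ.differentiable (by simp) _)).hasDerivWithinAt
  have hbound : ∀ r ∈ Icc (-T) T, ‖Ψ (r, y)‖ ≤ max L 0 := fun r hr =>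
    (hL r hr y).trans (le_max_left _ _)
  have h := (convex_Icc (-T) T).norm_image_sub_le_of_norm_hasDerivWithin_le hderiv hbound hs ht
  rw [Real.norm_eq_abs] at h
  exact h

/-- Uniform version of `exists_norm_cwd_lift_le` over all words of length `≤ K` (finitely many).
[cite: Friedrichs1954, §1] -/
theorem exists_norm_cwd_lift_le_of_length_le {F' : ℝ → UnitAddTorus ι → V}
    (hF : IsSmoothSpaceTimeOn univ F') (K : ℕ) (T : ℝ) :
    ∃ C, ∀ v : List ι, v.length ≤ K → ∀ t ∈ Icc (-T) T, ∀ y, ‖cwd v (lift (F' t)) y‖ ≤ C := by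
  choose C hC using fun v : List ι => exists_norm_cwd_lift_le hF v T
  have hfin : {v : List ι | v.length ≤ K}.Finite := List.finite_length_le ι K
  obtain ⟨M, hM⟩ := (hfin.image C).bddAbove
  exact ⟨M, fun v hv t ht y => (hC v t ht y).trans (hM (mem_image_of_mem C hv))⟩

/-- Uniform version of `exists_lipschitz_cwd_lift` over all words of length `≤ K`.
[cite: Friedrichs1954, §1] -/
theorem exists_lipschitz_cwd_lift_of_length_le {F' : ℝ → UnitAddTorus ι → V}
    (hF : IsSmoothSpaceTimeOn univ F') (K : ℕ) (T : ℝ) :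
    ∃ L, 0 ≤ L ∧ ∀ v : List ι, v.length ≤ K → ∀ s ∈ Icc (-T) T, ∀ t ∈ Icc (-T) T, ∀ y,
      ‖cwd v (lift (F' t)) y - cwd v (lift (F' s)) y‖ ≤ L * |t - s| := by
  choose L hL0 hL using fun v : List ι => exists_lipschitz_cwd_lift hF v T
  have hfin : {v : List ι | v.length ≤ K}.Finite := List.finite_length_le ι K
  obtain ⟨M, hM⟩ := (hfin.image L).bddAbove
  refine ⟨max M 0, le_max_right _ _, fun v hv s hs t ht y => (hL v s hs t ht y).trans ?_⟩
  exact mul_le_mul_of_nonneg_right ((hM (mem_image_of_mem L hv)).trans (le_max_left _ _))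
    (abs_nonneg _)

variable {W : Type*} [NormedAddCommGroup W] [InnerProductSpace ℝ W]

/-- **Periodic lifts of jointly smooth symmetric torus coefficients form a regular admissible
family** (`IsRegularSymmCoeffFamily`: the hypothesis of the tree's whole-space existence theorem
`exists_smooth_solution`). For `Aⱼ, B : ℝ × 𝕋^ι → (W →L[ℝ] W)` jointly `C^∞` with every
`Aⱼ(t, x)` symmetric, the lifts `(t, y) ↦ Aⱼ(t, proj y)`, `B(t, proj y)` are smooth, symmetric,
have word derivatives of every order bounded on `[-T, T] × ℝ^ι`, are jointly smooth, and have
word derivatives Lipschitz in time uniformly in space (Friedrichs 1954, §1: "coefficients …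
possess continuous derivatives … bounded", here automatic by periodicity and compactness).
[cite: Friedrichs1954, §1] -/
theorem isRegularSymmCoeffFamily_lift {A : ι → ℝ → UnitAddTorus ι → (W →L[ℝ] W)}
    {B : ℝ → UnitAddTorus ι → (W →L[ℝ] W)} (hA : ∀ j, IsSmoothSpaceTimeOn univ (A j))
    (hB : IsSmoothSpaceTimeOn univ B)
    (hsym : ∀ j t x (v w : W), ⟪A j t x v, w⟫_ℝ = ⟪v, A j t x w⟫_ℝ) :
    IsRegularSymmCoeffFamily (fun j t => lift (A j t)) (fun t => lift (B t)) where
  coeff T k := by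
    choose CA hCA using fun j => exists_norm_cwd_lift_le_of_length_le (hA j) (k + 1) T
    obtain ⟨CB, hCB⟩ := exists_norm_cwd_lift_le_of_length_le hB k T
    refine ⟨(∑ j, |CA j|) + |CB|, fun t ht => ?_⟩
    have hAle : ∀ j, CA j ≤ (∑ j, |CA j|) + |CB| := fun j =>
      ((le_abs_self _).trans (Finset.single_le_sum (fun i _ => abs_nonneg (CA i))
        (Finset.mem_univ j))).trans (le_add_of_nonneg_right (abs_nonneg _))
    have hBle : CB ≤ (∑ j, |CA j|) + |CB| :=
      (le_abs_self _).trans (le_add_of_nonneg_left (Finset.sum_nonneg fun i _ => abs_nonneg _))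
    exact
      { smoothA := fun j => (hA j).isSmooth_slice (mem_univ t)
        smoothB := hB.isSmooth_slice (mem_univ t)
        symm := fun j y v w => hsym j t (proj y) v w
        boundA := fun j v hv y => (hCA j v hv t ht y).trans (hAle j)
        boundB := fun v hv y => (hCB v hv t ht y).trans hBle }
  lip T := by
    choose LA hLA0 hLA using fun j => exists_lipschitz_cwd_lift (hA j) [] T
    obtain ⟨LB, hLB0, hLB⟩ := exists_lipschitz_cwd_lift hB [] T
    refine ⟨(∑ j, LA j) + LB, add_nonneg (Finset.sum_nonneg fun j _ => hLA0 j) hLB0,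
      fun s hs t ht y => ⟨fun j => ?_, ?_⟩⟩
    · have h := hLA j s hs t ht y
      simp only [cwd_nil] at h
      refine h.trans (mul_le_mul_of_nonneg_right ?_ (abs_nonneg _))
      exact (Finset.single_le_sum (fun i _ => hLA0 i) (Finset.mem_univ j)).trans
        (le_add_of_nonneg_right hLB0)
    · have h := hLB s hs t ht y
      simp only [cwd_nil] at h
      refine h.trans (mul_le_mul_of_nonneg_right ?_ (abs_nonneg _))
      exact le_add_of_nonneg_left (Finset.sum_nonneg fun j _ => hLA0 j)
  jointA j := contDiff_stLift_of_univ (hA j)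
  jointB := contDiff_stLift_of_univ hB
  lipk T k := by
    choose LA hLA0 hLA using fun j => exists_lipschitz_cwd_lift_of_length_le (hA j) k T
    obtain ⟨LB, hLB0, hLB⟩ := exists_lipschitz_cwd_lift_of_length_le hB k T
    refine ⟨(∑ j, LA j) + LB, add_nonneg (Finset.sum_nonneg fun j _ => hLA0 j) hLB0,
      fun s hs t ht y => ⟨fun j v hv => ?_, fun v hv => ?_⟩⟩
    · refine (hLA j v hv s hs t ht y).trans (mul_le_mul_of_nonneg_right ?_ (abs_nonneg _))
      exact (Finset.single_le_sum (fun i _ => hLA0 i) (Finset.mem_univ j)).trans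
        (le_add_of_nonneg_right hLB0)
    · refine (hLB v hv s hs t ht y).trans (mul_le_mul_of_nonneg_right ?_ (abs_nonneg _))
      exact le_add_of_nonneg_left (Finset.sum_nonneg fun j _ => hLA0 j)

end Periodic

/-! ## Part B: domain of dependence for the linear system on `ℝ × ℝⁿ` -/

section Cone

variable {n : ℕ}
variable {W : Type*} [NormedAddCommGroup W] [InnerProductSpace ℝ W]

/-- Coordinates are bounded by the Euclidean norm: `|ν j| ≤ ‖ν‖`. [folklore] -/
theorem abs_apply_le_norm_euclidean (ν : EuclideanSpace ℝ (Fin n)) (j : Fin n) : |ν j| ≤ ‖ν‖ := by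
  have h := PiLp.norm_apply_le ν j
  rwa [Real.norm_eq_abs] at h

/-- **Time reflection of a classical solution.** If `∂ₜD = ∑ⱼ aⱼ(t) ∂ⱼD + b(t) D` pointwise,
then `D⁻(t) = D(-t)` solves `∂ₜD⁻ = ∑ⱼ (-aⱼ(-t)) ∂ⱼD⁻ + (-b(-t)) D⁻`. [folklore] -/
theorem hasDerivAt_foOp_reflect {a : Fin n → ℝ → EuclideanSpace ℝ (Fin n) → (W →L[ℝ] W)}
    {b : ℝ → EuclideanSpace ℝ (Fin n) → (W →L[ℝ] W)} {D : ℝ → EuclideanSpace ℝ (Fin n) → W}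
    (heq : ∀ t y, HasDerivAt (fun s => D s y) (foOp (fun j => a j t) (b t) (D t) y) t) (t : ℝ)
    (y : EuclideanSpace ℝ (Fin n)) :
    HasDerivAt (fun s => D (-s) y)
      (foOp (fun j z => -a j (-t) z) (fun z => -b (-t) z) (D (-t)) y) t := by
  have h := (heq (-t) y).scomp t (hasDerivAt_neg t)
  have heq' : foOp (fun j z => -a j (-t) z) (fun z => -b (-t) z) (D (-t)) y =
      (-1 : ℝ) • foOp (fun j => a j (-t)) (b (-t)) (D (-t)) y := by
    simp only [foOp_apply, neg_apply, Finset.sum_neg_distrib, neg_smul,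
      one_smul, neg_add]
  rw [heq']
  exact h

/-- **Domain of dependence for linear symmetric hyperbolic systems on `ℝⁿ`, forward in time**
(Racke 2015, Thm 3.1; Friedrichs 1954, §6). Let `aⱼ` be jointly `C¹` symmetric operator fields
and `b` an operator field on `ℝ × ℝⁿ` with `‖aⱼ‖, ‖b‖, ‖∂ⱼaⱼ‖ ≤ M` on `[0, T] × ℝⁿ`, and let
`D` be a jointly `C¹` field with `∂ₜD(t, y) = ∑ⱼ aⱼ(t, y) ∂ⱼD(t, y) + b(t, y) D(t, y)` for all
`(t, y)` and `D(0, ·) = 0` on the closed ball `B̄(x₁, R)`. Then `D(t, y) = 0` whenever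
`0 < t ≤ T` and `dist(y, x₁) < R - n M t`: apply `coneEnergy_eq_zero` to the energy density
`e = ‖D‖²` and the fluxes `fⱼ = -⟪D, aⱼ D⟫`, for which `∂ₜe + ∑ⱼ∂ⱼfⱼ = 2⟪D, bD⟫ - ∑ⱼ⟪D, (∂ⱼaⱼ)D⟫
≤ (2 + n) M e` (symmetry of `aⱼ`, Racke (3.9)) and `|∑ νⱼfⱼ| ≤ n M e` for `‖ν‖ ≤ 1`
(Racke (3.11)). [cite: Racke2015, Ch. 3 Thm 3.1] -/
theorem symmHyp_eq_zero_of_data_zero_ball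
    {a : Fin n → ℝ → EuclideanSpace ℝ (Fin n) → (W →L[ℝ] W)}
    {b : ℝ → EuclideanSpace ℝ (Fin n) → (W →L[ℝ] W)} {D : ℝ → EuclideanSpace ℝ (Fin n) → W}
    {T M : ℝ} (ha : ∀ j, ContDiff ℝ 1 fun p : ℝ × EuclideanSpace ℝ (Fin n) => a j p.1 p.2)
    (hsym : ∀ j t y (v w : W), ⟪a j t y v, w⟫_ℝ = ⟪v, a j t y w⟫_ℝ) (hM : 0 ≤ M)
    (hba : ∀ j, ∀ t ∈ Icc 0 T, ∀ y, ‖a j t y‖ ≤ M) (hbb : ∀ t ∈ Icc 0 T, ∀ y, ‖b t y‖ ≤ M)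
    (hbda : ∀ j, ∀ t ∈ Icc 0 T, ∀ y, ‖fderiv ℝ (a j t) y (bv j)‖ ≤ M)
    (hD : ContDiff ℝ 1 fun p : ℝ × EuclideanSpace ℝ (Fin n) => D p.1 p.2)
    (heq : ∀ t y, HasDerivAt (fun s => D s y) (foOp (fun j => a j t) (b t) (D t) y) t)
    {x₁ : EuclideanSpace ℝ (Fin n)} {R : ℝ} (h0 : ∀ y ∈ closedBall x₁ R, D 0 y = 0)
    {t : ℝ} (ht : t ∈ Ioc 0 T) {y : EuclideanSpace ℝ (Fin n)}
    (hy : dist y x₁ < R - (n * M) * t) : D t y = 0 := by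
  -- energy density and fluxes
  set e : ℝ × EuclideanSpace ℝ (Fin n) → ℝ := fun p => ‖D p.1 p.2‖ ^ 2 with he_def
  set f : Fin n → ℝ × EuclideanSpace ℝ (Fin n) → ℝ := fun j p =>
    -⟪D p.1 p.2, a j p.1 p.2 (D p.1 p.2)⟫_ℝ with hf_def
  have hediff : ContDiff ℝ 1 e := hD.norm_sq ℝ
  have hfdiff : ∀ j, ContDiff ℝ 1 (f j) := fun j => (hD.inner ℝ ((ha j).clm_apply hD)).neg
  -- a bound for `De` on the compact slab piece
  obtain ⟨C, hC⟩ := (isCompact_Icc.prod (isCompact_closedBall x₁ R)).exists_bound_of_continuousOn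
    (s := Icc 0 T ×ˢ closedBall x₁ R) ((hediff.continuous_fderiv one_ne_zero).continuousOn)
  -- slices of `D` and `a j`
  have hDt : ∀ t, Differentiable ℝ (D t) := fun t =>
    (hD.comp (contDiff_prodMk_right t)).differentiable one_ne_zero
  have hat : ∀ j t, Differentiable ℝ (a j t) := fun j t =>
    ((ha j).comp (contDiff_prodMk_right t)).differentiable one_ne_zero
  -- the time derivative of the energy density
  have hte : ∀ (t : ℝ) (y : EuclideanSpace ℝ (Fin n)), fderiv ℝ e (t, y) (1, 0) =
      2 * ⟪D t y, foOp (fun j => a j t) (b t) (D t) y⟫_ℝ := by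
    intro t y
    have h1 : HasDerivAt (fun s => e (s, y)) (fderiv ℝ e (t, y) (1, 0)) t :=
      hasDerivAt_slice (p := (t, y)) (hediff.differentiable one_ne_zero _)
    have h2 : HasDerivAt (fun s => e (s, y)) (2 * ⟪D t y, foOp (fun j => a j t) (b t) (D t) y⟫_ℝ) t :=
      (heq t y).norm_sq
    exact h1.unique h2
  -- the space derivative of the fluxes
  have hxf : ∀ (j : Fin n) (t : ℝ) (y : EuclideanSpace ℝ (Fin n)),
      fderiv ℝ (f j) (t, y) (0, EuclideanSpace.single j 1) =
        -(2 * ⟪D t y, a j t y (fderiv ℝ (D t) y (bv j))⟫_ℝ +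
          ⟪D t y, (fderiv ℝ (a j t) y (bv j)) (D t y)⟫_ℝ) := by
    intro j t y
    rw [← bv_eq_single, ← fderiv_slice_apply (p := (t, y)) ((hfdiff j).differentiable one_ne_zero _)]
    have hD' : HasFDerivAt (D t) (fderiv ℝ (D t) y) y := (hDt t y).hasFDerivAt
    have ha' : HasFDerivAt (a j t) (fderiv ℝ (a j t) y) y := (hat j t y).hasFDerivAt
    have hg : HasFDerivAt (fun z => f j (t, z))
        (-((fderivInnerCLM ℝ (D t y, a j t y (D t y))).comp
          ((fderiv ℝ (D t) y).prod ((a j t y).comp (fderiv ℝ (D t) y) +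
            (fderiv ℝ (a j t) y).flip (D t y))))) y :=
      (hD'.inner ℝ (ha'.clm_apply hD')).neg
    rw [hg.fderiv]
    simp only [neg_apply, ContinuousLinearMap.comp_apply,
      ContinuousLinearMap.prod_apply, fderivInnerCLM_apply, add_apply,
      ContinuousLinearMap.flip_apply]
    rw [inner_add_right, ← hsym j t y (fderiv ℝ (D t) y (bv j)) (D t y),
      real_inner_comm (D t y) (a j t y (fderiv ℝ (D t) y (bv j)))]
    ring
  refine norm_eq_zero.1 (pow_eq_zero_iff two_ne_zero |>.1 ?_)
  show e (t, y) = 0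
  refine Literature.Analysis.FluidPDE.coneEnergy_eq_zero (τ := 0) (τ' := T) (ρ := R)
    (c := n * M) (M := 2 * M + n * M) (C := C) (x₁ := x₁) (e := e) (f := f)
    (by positivity) hediff.continuous.continuousOn (hediff.contDiffOn)
    (fun j => (hfdiff j).contDiffOn) (fun p hp => hC p ⟨Ioo_subset_Icc_self hp.1, hp.2⟩)
    (fun p _ => sq_nonneg _) ?_ ?_ (fun z hz => by simp [he_def, h0 z hz]) ht (by simpa using hy)
  · -- bulk inequality
    rintro ⟨s, z⟩ ⟨hs, -⟩
    have hs' : s ∈ Icc 0 T := Ioo_subset_Icc_self hs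
    rw [hte s z]
    simp_rw [hxf _ s z]
    rw [foOp_apply, inner_add_right, inner_sum]
    have hsplit : ∑ j : Fin n, -(2 * ⟪D s z, a j s z (fderiv ℝ (D s) z (bv j))⟫_ℝ +
        ⟪D s z, (fderiv ℝ (a j s) z (bv j)) (D s z)⟫_ℝ) =
        -(2 * ∑ j : Fin n, ⟪D s z, a j s z (fderiv ℝ (D s) z (bv j))⟫_ℝ) +
          ∑ j : Fin n, -⟪D s z, (fderiv ℝ (a j s) z (bv j)) (D s z)⟫_ℝ := by
      rw [Finset.mul_sum, ← Finset.sum_neg_distrib, ← Finset.sum_add_distrib]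
      exact Finset.sum_congr rfl fun j _ => by ring
    rw [hsplit]
    have he : e (s, z) = ‖D s z‖ ^ 2 := rfl
    rw [he]
    have hb1 : ⟪D s z, b s z (D s z)⟫_ℝ ≤ M * ‖D s z‖ ^ 2 := by
      calc ⟪D s z, b s z (D s z)⟫_ℝ ≤ ‖D s z‖ * ‖b s z (D s z)‖ := real_inner_le_norm _ _
        _ ≤ ‖D s z‖ * (M * ‖D s z‖) := by
          gcongr
          exact (b s z).le_of_opNorm_le (hbb s hs' z) _
        _ = M * ‖D s z‖ ^ 2 := by ring
    have hb2 : ∀ j, -⟪D s z, (fderiv ℝ (a j s) z (bv j)) (D s z)⟫_ℝ ≤ M * ‖D s z‖ ^ 2 := by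
      intro j
      calc -⟪D s z, (fderiv ℝ (a j s) z (bv j)) (D s z)⟫_ℝ
          ≤ |⟪D s z, (fderiv ℝ (a j s) z (bv j)) (D s z)⟫_ℝ| := neg_le_abs _
        _ ≤ ‖D s z‖ * ‖(fderiv ℝ (a j s) z (bv j)) (D s z)‖ := abs_real_inner_le_norm _ _
        _ ≤ ‖D s z‖ * (M * ‖D s z‖) := by
          gcongr
          exact (fderiv ℝ (a j s) z (bv j)).le_of_opNorm_le (hbda j s hs' z) _
        _ = M * ‖D s z‖ ^ 2 := by ring
    have hsum : ∑ j : Fin n, -⟪D s z, (fderiv ℝ (a j s) z (bv j)) (D s z)⟫_ℝ ≤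
        n * (M * ‖D s z‖ ^ 2) := by
      calc ∑ j : Fin n, -⟪D s z, (fderiv ℝ (a j s) z (bv j)) (D s z)⟫_ℝ
          ≤ ∑ _j : Fin n, M * ‖D s z‖ ^ 2 := Finset.sum_le_sum fun j _ => hb2 j
        _ = n * (M * ‖D s z‖ ^ 2) := by simp
    nlinarith
  · -- cone condition
    rintro ⟨s, z⟩ ⟨hs, -⟩ ν hν
    have hterm : ∀ j, |ν j * f j (s, z)| ≤ M * ‖D s z‖ ^ 2 := by
      intro j
      rw [abs_mul]
      have h1 : |ν j| ≤ 1 := (abs_apply_le_norm_euclidean ν j).trans hν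
      have h2 : |f j (s, z)| ≤ M * ‖D s z‖ ^ 2 := by
        simp only [hf_def, abs_neg]
        calc |⟪D s z, a j s z (D s z)⟫_ℝ| ≤ ‖D s z‖ * ‖a j s z (D s z)‖ :=
              abs_real_inner_le_norm _ _
          _ ≤ ‖D s z‖ * (M * ‖D s z‖) := by
            gcongr
            exact (a j s z).le_of_opNorm_le (hba j s hs z) _
          _ = M * ‖D s z‖ ^ 2 := by ring
      calc |ν j| * |f j (s, z)| ≤ 1 * (M * ‖D s z‖ ^ 2) := by
            gcongr
        _ = M * ‖D s z‖ ^ 2 := one_mul _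
    calc |∑ j, ν j * f j (s, z)| ≤ ∑ j, |ν j * f j (s, z)| := Finset.abs_sum_le_sum_abs _ _
      _ ≤ ∑ _j : Fin n, M * ‖D s z‖ ^ 2 := Finset.sum_le_sum fun j _ => hterm j
      _ = n * M * e (s, z) := by simp [he_def]; ring

/-- **Domain of dependence, both time directions.** Under the hypotheses of
`symmHyp_eq_zero_of_data_zero_ball` with the coefficient bounds on `[-T, T] × ℝⁿ`, a jointly
`C¹` solution vanishing at `t = 0` on `B̄(x₁, R)` vanishes at `(t, y)` whenever `|t| ≤ T` and
`dist(y, x₁) < R - n M |t|` (negative times by time reflection, `hasDerivAt_foOp_reflect`).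
[cite: Racke2015, Ch. 3 Thm 3.1] -/
theorem symmHyp_eq_zero_of_data_zero_ball_abs
    {a : Fin n → ℝ → EuclideanSpace ℝ (Fin n) → (W →L[ℝ] W)}
    {b : ℝ → EuclideanSpace ℝ (Fin n) → (W →L[ℝ] W)} {D : ℝ → EuclideanSpace ℝ (Fin n) → W}
    {T M : ℝ} (ha : ∀ j, ContDiff ℝ 1 fun p : ℝ × EuclideanSpace ℝ (Fin n) => a j p.1 p.2)
    (hb : ContDiff ℝ 1 fun p : ℝ × EuclideanSpace ℝ (Fin n) => b p.1 p.2)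
    (hsym : ∀ j t y (v w : W), ⟪a j t y v, w⟫_ℝ = ⟪v, a j t y w⟫_ℝ) (hM : 0 ≤ M)
    (hba : ∀ j, ∀ t ∈ Icc (-T) T, ∀ y, ‖a j t y‖ ≤ M)
    (hbb : ∀ t ∈ Icc (-T) T, ∀ y, ‖b t y‖ ≤ M)
    (hbda : ∀ j, ∀ t ∈ Icc (-T) T, ∀ y, ‖fderiv ℝ (a j t) y (bv j)‖ ≤ M)
    (hD : ContDiff ℝ 1 fun p : ℝ × EuclideanSpace ℝ (Fin n) => D p.1 p.2)
    (heq : ∀ t y, HasDerivAt (fun s => D s y) (foOp (fun j => a j t) (b t) (D t) y) t)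
    {x₁ : EuclideanSpace ℝ (Fin n)} {R : ℝ} (h0 : ∀ y ∈ closedBall x₁ R, D 0 y = 0)
    {t : ℝ} (ht : |t| ≤ T) {y : EuclideanSpace ℝ (Fin n)}
    (hy : dist y x₁ < R - (n * M) * |t|) : D t y = 0 := by
  have _ := hb
  rcases lt_trichotomy t 0 with hneg | rfl | hpos
  · -- negative times: reflect
    have hrefl : ContDiff ℝ 1 fun p : ℝ × EuclideanSpace ℝ (Fin n) => ((-p.1, p.2) :
        ℝ × EuclideanSpace ℝ (Fin n)) := contDiff_neg.fst'.prodMk contDiff_snd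
    have ha' : ∀ j, ContDiff ℝ 1 fun p : ℝ × EuclideanSpace ℝ (Fin n) => -a j (-p.1) p.2 :=
      fun j => ((ha j).comp hrefl).neg
    have hD' : ContDiff ℝ 1 fun p : ℝ × EuclideanSpace ℝ (Fin n) => D (-p.1) p.2 := hD.comp hrefl
    have hsym' : ∀ j s z (v w : W), ⟪(-a j (-s) z) v, w⟫_ℝ = ⟪v, (-a j (-s) z) w⟫_ℝ := by
      intro j s z v w
      simp only [neg_apply, inner_neg_left, inner_neg_right, hsym]
    have hba' : ∀ j, ∀ s ∈ Icc 0 T, ∀ z, ‖-a j (-s) z‖ ≤ M := fun j s hs z => by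
      rw [norm_neg]; exact hba j (-s) ⟨by linarith [hs.1, hs.2], by linarith [hs.1, hs.2]⟩ z
    have hbb' : ∀ s ∈ Icc 0 T, ∀ z, ‖-b (-s) z‖ ≤ M := fun s hs z => by
      rw [norm_neg]; exact hbb (-s) ⟨by linarith [hs.1, hs.2], by linarith [hs.1, hs.2]⟩ z
    have hbda' : ∀ j, ∀ s ∈ Icc 0 T, ∀ z,
        ‖fderiv ℝ (fun z => -a j (-s) z) z (bv j)‖ ≤ M := fun j s hs z => by
      have h : (fun z => -a j (-s) z) = -(a j (-s)) := rfl
      rw [h, fderiv_neg, neg_apply, norm_neg]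
      exact hbda j (-s) ⟨by linarith [hs.1, hs.2], by linarith [hs.1, hs.2]⟩ z
    have h := symmHyp_eq_zero_of_data_zero_ball (a := fun j s z => -a j (-s) z)
      (b := fun s z => -b (-s) z) (D := fun s z => D (-s) z) (T := T) (M := M) ha' hsym' hM
      hba' hbb' hbda' hD' (hasDerivAt_foOp_reflect heq) (x₁ := x₁) (R := R)
      (fun z hz => by simpa using h0 z hz) (t := -t) ⟨by linarith, by rwa [abs_of_neg hneg] at ht⟩
      (y := y) (by rwa [abs_of_neg hneg] at hy)
    simpa using h
  · refine h0 y (mem_closedBall.2 ?_)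
    simpa using hy.le
  · exact symmHyp_eq_zero_of_data_zero_ball ha hsym hM
      (fun j s hs z => hba j s ⟨by linarith [hs.1, hs.2], hs.2⟩ z)
      (fun s hs z => hbb s ⟨by linarith [hs.1, hs.2], hs.2⟩ z)
      (fun j s hs z => hbda j s ⟨by linarith [hs.1, hs.2], hs.2⟩ z) hD heq h0
      ⟨hpos, by rwa [abs_of_pos hpos] at ht⟩ (by rwa [abs_of_pos hpos] at hy)

end Cone

end Literature.Analysis.PDE

end
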